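import Summits.Ventures.HSemireg.Pad4TowerLineMoments

set_option linter.dupNamespace false

/-!
# `U_h` — a uniform CAPACITY-CLEAN two-term UP LINE design at every even height `h = 2n ≥ 4` (control g7, lens «control», 2026-08-29)

Nothing here proves HC, HC_AV, HC_CM, H2 or item 18881; census-neutral; no fact, no instance, no notation, SORRY-FREE
(the object-level claims are stated as `Prop`s, the orbit-level arithmetic is proved).  Pen memo + exact machine checks:
`Cruxes/BlochSeedDiscOne/CAPFREE-U-g7.md` (cell-level verifier `verify_U.py`; ×2 by bc5-plan g12's instruments of record
`support_screen.py` ((H1) residual 0), `rb_branch.py --cap ∕ --deficit` (FEASIBLE, D_min = 0), `splitsummand.py` (silent)).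

THE DESIGN (mass per cell; `u, u_f ∈ μ₄`; the CLASS of a fully charged cell is the sum of its four phases in `ZMod 4`):
* `N`:  `A  = (n·u ∣ apex ∣ apex ∣ apex)`           16 cells,  `m = 32`
        `B₀ = (n, n, n, n−1)`, class `0`            256 cells,  `m = n + 1`
* `P`:  `C  = (n, n, n ∣ apex)`                      256 cells,  `m = 1`
        `B₂ = (n, n, n, n−1)`, class `2`            256 cells,  `m = 1`
        `T₀ = (n, n, n, n)`, class `0`                64 cells,  `m = 4(n−1)`
(848 cells; rank `16·32 + 256(n+1) − 256 − 256 − 256(n−1) = 512`; `μ = 512·n³(n−1) = 32·h³(h−2)`, real — the other three sign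
classes by rotating the phase of one factor).  WHY IT IS CLEAN (pen, memo §2): the phase group `T₀ = {s : Σ s_f ≡ 0 (4)}` acts on
each block, so every mixed (M)-word except `E₂, E₃, E₄` vanishes by a character argument; in the phase-free rows the `B₀` and `B₂`
copies cancel `1 : 1` and what is left is the identity `n·e_k(n,n,n,n−1) = e_k(n,n,n,0) + (n−1)·e_k(n,n,n,n)` (`e_k(n,n,n,x)` is affine
in `x`) with weights `256·n : 256·1 : 64·4(n−1)` — `U_E2 ∕ U_E3 ∕ U_E4` below; `μ` only sees the `B₀ + B₂` copies against `T₀`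
(`U_mu`).  CAPACITY (bc5 §16, cell level, `h⁰ = Π_f max(1, d_f)` along slides): a `B₀` cell is fed only by its unique `T₀` parent
(`d = (0,0,0,1)`, `h⁰ = 1`): `n + 1 ≤ 4(n−1)` iff `n ≥ 2` (`U_capacity_B0`); an `A` cell is fed by everything above it.  UP HALL:
the integral flow `π(T₀ → each of its 4 B₀-children) = n−1`, `π(C ∣ B₂ with the odd slot at g → the A-cell of slot g+1 and that
cell's phase there) = 1` saturates `P` and fills `A` exactly (`16 + 16 = 32`), `B₀` to `n−1 ≤ n+1` (`U_flow_T0`, `U_flow_A`).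
What is NOT claimed: anything at object level beyond design ∕ class ∕ Hall ∕ capacity ∕ split-summand — (B2), PP, StaticFour,
the sheaf door, BF-semiregularity of `coker φ` are untouched; `h = 2` is infeasible (capacity LP, memo §3).
-/

namespace Summit.HodgeConjecture.HodgeConjecture.Cruxes.BlochSeedDiscOne.CapFreeU

open Finset BigOperators Summit.Ventures.HSemireg Summit.Ventures.HSemireg.Pad4Tower
  Summit.Ventures.HSemireg.LinePhaseTorus

/-! ## §1 the cells of `U_h` over the tree's LINE letters -/

/-- the class of a phase vector: `Σ_f τ_f ∈ ZMod 4` (read in `Fin 4`). -/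
def phaseClass (τ : Fin 4 → Fin 4) : Fin 4 := τ 0 + τ 1 + τ 2 + τ 3

/-- the LINE-`h` cell with charges `cs` and phases `τ` (`lineLetter h 0 k` is the apex for every `k`). -/
def cellOf (h : ℤ) (cs : Fin 4 → ℕ) (τ : Fin 4 → Fin 4) : MCell := fun f => lineLetter h (cs f) (τ f)

/-- charge pattern `A`: charge `n` in slot `g`, apex elsewhere. -/
def csA (n : ℕ) (g : Fin 4) : Fin 4 → ℕ := Function.update (fun _ => 0) g n
/-- charge pattern `B`: `(n,n,n,n−1)` with the `n−1` in slot `g`. -/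
def csB (n : ℕ) (g : Fin 4) : Fin 4 → ℕ := Function.update (fun _ => n) g (n - 1)
/-- charge pattern `C`: `(n,n,n ∣ apex)` with the apex in slot `g`. -/
def csC (n : ℕ) (g : Fin 4) : Fin 4 → ℕ := Function.update (fun _ => n) g 0
/-- charge pattern `T`: `(n,n,n,n)`. -/
def csT (n : ℕ) : Fin 4 → ℕ := fun _ => n

/-- slot × phase-vector index. -/
abbrev Idx := Fin 4 × (Fin 4 → Fin 4)

/-- the 16 `A` cells. -/
def cellsA (n : ℕ) : Finset MCell := (univ : Finset Idx).image fun i => cellOf (2 * n) (csA n i.1) i.2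
/-- the 256 `B₀` cells (class `0`). -/
def cellsB0 (n : ℕ) : Finset MCell :=
  ((univ : Finset Idx).filter fun i => phaseClass i.2 = 0).image fun i => cellOf (2 * n) (csB n i.1) i.2
/-- the 256 `B₂` cells (class `2`). -/
def cellsB2 (n : ℕ) : Finset MCell :=
  ((univ : Finset Idx).filter fun i => phaseClass i.2 = 2).image fun i => cellOf (2 * n) (csB n i.1) i.2
/-- the 256 `C` cells. -/
def cellsC (n : ℕ) : Finset MCell := (univ : Finset Idx).image fun i => cellOf (2 * n) (csC n i.1) i.2
/-- the 64 `T₀` cells (class `0`). -/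
def cellsT0 (n : ℕ) : Finset MCell :=
  ((univ : Finset (Fin 4 → Fin 4)).filter fun τ => phaseClass τ = 0).image fun τ => cellOf (2 * n) (csT n) τ

/-- the configuration `U_h`, `h = 2n`: `N = A ∪ B₀`, `P = C ∪ B₂ ∪ T₀`. -/
def UConfig (n : ℕ) : MConfig := ⟨cellsA n ∪ cellsB0 n, cellsC n ∪ cellsB2 n ∪ cellsT0 n⟩

/-- `N`-multiplicities of `U_h`. -/
def UmN (n : ℕ) (Z : MCell) : ℤ :=
  (if Z ∈ cellsA n then 32 else 0) + (if Z ∈ cellsB0 n then (n : ℤ) + 1 else 0)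

/-- `P`-multiplicities of `U_h`. -/
def UmP (n : ℕ) (Z : MCell) : ℤ :=
  (if Z ∈ cellsC n then 1 else 0) + (if Z ∈ cellsB2 n then 1 else 0) +
    (if Z ∈ cellsT0 n then 4 * ((n : ℤ) - 1) else 0)

/-! ## §2 the object-level claims (stated; checked by exact arithmetic outside the kernel, memo §2–§4) -/

/-- CLAIM 1 — (A1)∕(H1) at class level: the class word table of `U_h` passes `ClassScreen`
(verify_U.py: every mixed ∕ lower (M)-word is `0`; bc5 `support_screen.py`: (H1) residual `0`, THEOREM-LC frame). -/
def UClassClean (n : ℕ) : Prop := ClassScreen ((UConfig n).wch (UmN n) (UmP n))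

/-- CLAIM 2 — a `P`-saturating UP flow exists (the explicit integral flow of the module docstring; max-flow = `Σ m_P`). -/
def UHasUpFlow (n : ℕ) : Prop := Nonempty (UpFlow (UConfig n) (UmN n) (UmP n))

/-- CLAIM 3 — the Weil coefficient: `μ(U_h) = wch eWord = 512·n³(n−1)` (real, non-zero for `n ≥ 2`). -/
def UMuValue (n : ℕ) : Prop := (UConfig n).wch (UmN n) (UmP n) eWord = ⟨512 * (n : ℤ) ^ 3 * (n - 1), 0⟩

/-- the first lemma of the line, as one statement: `U_h` is an (A1)-clean two-term UP LINE design with `μ ≠ 0`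
(capacity-cleanness is the cell-level inequality `U_capacity_B0` + coverage of `A`; memo §4). -/
def UIsAddress (n : ℕ) : Prop := UClassClean n ∧ UHasUpFlow n ∧ UMuValue n

/-! ## §3 the orbit-level arithmetic (proved): E-balance, `μ`, rank, capacity slack, flow bookkeeping -/

/-- `E₂`-row of `U_h`: `256·[n·e₂(n,n,n,n−1) − e₂(n,n,n,0)] − 64·4(n−1)·e₂(n,n,n,n) = 0`
(`e₂(n,n,n,x) = 3n² + 3n·x`; the `B₀`/`B₂` copies cancel to the net weight `n`). -/
theorem U_E2 (n : ℤ) :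
    256 * (n * (3 * n ^ 2 + 3 * n * (n - 1)) - (3 * n ^ 2 + 3 * n * 0)) - 64 * (4 * (n - 1)) * (6 * n ^ 2) = 0 := by
  ring

/-- `E₃`-row (`e₃(n,n,n,x) = n³ + 3n²·x`). -/
theorem U_E3 (n : ℤ) :
    256 * (n * (n ^ 3 + 3 * n ^ 2 * (n - 1)) - (n ^ 3 + 3 * n ^ 2 * 0)) - 64 * (4 * (n - 1)) * (4 * n ^ 3) = 0 := by
  ring

/-- `E₄`-row (`e₄(n,n,n,x) = n³·x`). -/
theorem U_E4 (n : ℤ) :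
    256 * (n * (n ^ 3 * (n - 1)) - n ^ 3 * 0) - 64 * (4 * (n - 1)) * n ^ 4 = 0 := by
  ring

/-- `μ`: only the fully charged cells count, `B₀` (`N`, class 0, `+V`) and `B₂` (`P`, class 2, `−(−V)`) with `V = n³(n−1)`
against `T₀` (`P`, class 0, `−n⁴`): `256·(n+1+1)·n³(n−1) − 64·4(n−1)·n⁴ = 512·n³(n−1)`. -/
theorem U_mu (n : ℤ) :
    256 * ((n + 1) + 1) * (n ^ 3 * (n - 1)) - 64 * (4 * (n - 1)) * n ^ 4 = 512 * n ^ 3 * (n - 1) := by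
  ring

/-- rank of `U_h` is `512` at every height. -/
theorem U_rank (n : ℤ) : 16 * 32 + 256 * (n + 1) - (256 * 1 + 256 * 1 + 64 * (4 * (n - 1))) = 512 := by
  ring

/-- CAPACITY at a `B₀` cell (its only parents are the `4(n−1)` copies of its `T₀` parent, `h⁰ = 1`): clean iff `n ≥ 2`. -/
theorem U_capacity_B0 (n : ℕ) (hn : 2 ≤ n) : (n : ℤ) + 1 ≤ 4 * ((n : ℤ) - 1) * 1 := by
  omega

/-- at `h = 2` (`n = 1`) the same inequality fails — consistent with the capacity LP verdict INFEASIBLE at `h = 2` (memo §3). -/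
theorem U_capacity_B0_fails_at_one : ¬ ((1 : ℤ) + 1 ≤ 4 * ((1 : ℤ) - 1) * 1) := by
  norm_num

/-- flow bookkeeping at a `T₀` cell: `n−1` units to each of its four `B₀` children exhaust its mass `4(n−1)`. -/
theorem U_flow_T0 (n : ℤ) : 4 * (n - 1) = (n - 1) + (n - 1) + (n - 1) + (n - 1) := by
  ring

/-- flow bookkeeping at an `A` cell: it receives one unit from each of the 16 `C` cells and the 16 `B₂` cells routed to it. -/
theorem U_flow_A : (16 : ℤ) * 1 + 16 * 1 = 32 := by
  norm_num

/-- flow bookkeeping at a `B₀` cell: it receives `n−1 ≤ n+1` from its `T₀` parent (residual `2`). -/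
theorem U_flow_B0 (n : ℤ) : n - 1 ≤ n + 1 := by
  omega

end Summit.HodgeConjecture.HodgeConjecture.Cruxes.BlochSeedDiscOne.CapFreeU
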